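import Summits.Ventures.PercRepro.C025ProfileThinAllQ
import Summits.Ventures.PercRepro.RankLevelSetFrameQ

/-!
# C-025 AT `(q + 2, q)` ON EVERY THIN(q) MATROID — simplicity dropped (night-3 g17)
g16's `rls_succ_succ_thin_simple` (`C025ProfileThinAllQ`) gives the rank level-set inequality `ThmN.RLS M (q + 2) q` on every finite
SIMPLE matroid in which every rank-`q` set has at most `q + 1` points (THIN(q)).  This module removes the simplicity hypothesis for
`q ≥ 2`, without any new certificate: the profile rows stay where they are and the reduction is done at the level of C-025 itself with
the tree's single-element steps (p3's Theorem F, night-1's wrappers `ThmN.RLS_of_loop_q` / `ThmN.RLS_of_parallel_q`).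
* THE STRUCTURE: below rank `q` a thin(q) matroid of rank `≥ q` has nullity `≤ 1` (g15's `card_le_rkN_add_one_of_between` with
  `Y = E`), so it carries at most ONE defect — a single loop or a single parallel pair.  Concretely: if `e` is a loop, every dependent
  set `T` of `≤ 2` points of `M ＼ {e}` gives `T ∪ {e}` of nullity `≥ 2` (`simple_delete_of_isLoop`); if `e ∥ e'`, every such `T` of
  `M ＼ {e}` gives `T ∪ {e, e'}` of nullity `≥ 2` (`simple_delete_of_parallel`), and every dependent `T` of `≤ 2` points of
  `(M ／ {e}) ＼ {e'}` gives `T ∪ {e, e'}` of nullity `≥ 2` in `M` (`simple_contract_delete_of_parallel`).  All three need only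
  `rank ≤ 2 ≤ q`, which is why `q ≥ 2` is assumed (for `q ≤ 3` the row is the tree's Theorem N / Theorem O anyway).
* THE REDUCTION: `ρ(E) < q + 2` is empty (`RLS_of_eRank_lt`); a LOOP `e` halves both counts (`RLS_of_loop_q`) into g16's theorem on
  `M ＼ {e}`, which is simple and thin(q) (`thin_delete`); a PARALLEL PAIR `e ∥ e'` is Theorem F (`RLS_of_parallel_q`) fed with `M ＼ {e}`
  at `(q + 2, q)` (simple, thin(q): g16) and `M ／ {e}` at `(q + 1, q − 1)`: there `e'` is a loop (`isLoop_contract_of_mem_closure`),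
  and `(M ／ {e}) ＼ {e'}` is simple and thin(q − 1) (`thin_contract_delete`: `ρ_{M/e}(X) = q − 1 ⟺ ρ_M(X ∪ {e}) = q`), so g16's theorem
  at `q − 1` and one more halving close it.
* **`rls_succ_succ_thin`**: for every `q ≥ 2` and every finite matroid in which every rank-`q` set has at most `q + 1` points,
  `ThmN.RLS M (q + 2) q` — C-025 at `(q + 2, q)` on the WHOLE thin regime, simple or not; `rls_succ_succ_thin_indep` states thinness in
  `M.Indep` / `encard` terms.
No `def`, no `instance`, no notation.  Axioms: standard.
-/
open scoped Matroid
namespace PercRepro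
open Set Finset ThmH Staged
namespace ThinGirth
variable {α : Type} [DecidableEq α] {M : Matroid α} [M.Finite]

omit [DecidableEq α] in
/-- A point of the ground set is a point of `gr M`. -/
theorem mem_gr_of_mem_ground {x : α} (hx : x ∈ M.E) : x ∈ gr M := by
  have : x ∈ ((gr M : Finset α) : Set α) := by rw [coe_gr]; exact hx
  exact_mod_cast this

omit [DecidableEq α] in
/-- A subset of the ground set, as a `Finset`, is a subset of `gr M`. -/
theorem subset_gr_of_coe_subset {X : Finset α} (hX : (X : Set α) ⊆ M.E) : X ⊆ gr M :=
  fun _ hx => mem_gr_of_mem_ground (hX (Finset.mem_coe.2 hx))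

omit [DecidableEq α] in
/-- A dependent finite set has rank strictly below its cardinality. -/
theorem rkN_lt_card_of_not_indep {X : Finset α} (h : ¬ M.Indep (X : Set α)) : rkN M X < X.card := by
  rcases Nat.lt_or_ge (rkN M X) X.card with hlt | hge
  · exact hlt
  · exfalso
    apply h
    have heq : rkN M X = X.card := le_antisymm (rkN_le_card X) hge
    rw [Matroid.indep_iff_eRk_eq_encard_of_finite X.finite_toSet, Set.encard_coe_eq_coe_finsetCard, ← coe_rkN, heq]

omit [DecidableEq α] in
/-- A finite matroid that is not simple has a dependent set of at most two points, as a `Finset`. -/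
theorem exists_finset_of_not_simple (N : Matroid α) [N.Finite]
    (h : ¬ ∀ T ⊆ N.E, T.encard ≤ 2 → N.Indep T) :
    ∃ X : Finset α, (X : Set α) ⊆ N.E ∧ X.card ≤ 2 ∧ ¬ N.Indep (X : Set α) := by
  push Not at h
  obtain ⟨T, hTE, hT2, hTdep⟩ := h
  obtain ⟨X, rfl⟩ := (N.ground_finite.subset hTE).exists_finset_coe
  refine ⟨X, hTE, ?_, hTdep⟩
  rw [Set.encard_coe_eq_coe_finsetCard] at hT2
  exact_mod_cast hT2

/-- In a thin(q) matroid of rank `≥ q`, every set of rank `≤ q` has nullity `≤ 1`. -/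
theorem card_le_rkN_add_one_of_thin {q : ℕ} (hthin : ∀ X ⊆ gr M, rkN M X = q → X.card ≤ q + 1)
    (hE : q ≤ rkN M (gr M)) {X : Finset α} (hX : X ⊆ gr M) (hXq : rkN M X ≤ q) : X.card ≤ rkN M X + 1 :=
  ThinTriangle.card_le_rkN_add_one_of_between hthin hX (Finset.Subset.refl _) hXq hE

omit [DecidableEq α] in
/-- Thinness passes to the deletion `M ＼ {e}` (ranks of sets avoiding `e` are unchanged). -/
theorem thin_delete {q : ℕ} (hthin : ∀ X ⊆ gr M, rkN M X = q → X.card ≤ q + 1) (e : α) :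
    ∀ X ⊆ gr (M ＼ {e}), rkN (M ＼ {e}) X = q → X.card ≤ q + 1 := by
  intro X hX hXr
  have hXE : (X : Set α) ⊆ M.E \ {e} := by
    rw [← Matroid.delete_ground, ← coe_gr]
    exact_mod_cast hX
  apply hthin X (subset_gr_of_coe_subset (hXE.trans Set.sdiff_subset))
  rw [rkN_eq_iff] at hXr ⊢
  rwa [delete_singleton_eRk_eq hXE] at hXr

/-- Thinness at level `q + 1` passes to `(M ／ {e}) ＼ {e'}` at level `q`: `ρ_{M/e}(X) = q` means `ρ_M(X ∪ {e}) = q + 1`. -/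
theorem thin_contract_delete {q : ℕ} (hthin : ∀ X ⊆ gr M, rkN M X = q + 1 → X.card ≤ q + 2)
    {e e' : α} (he : M.Indep {e}) :
    ∀ X ⊆ gr ((M ／ {e}) ＼ {e'}), rkN ((M ／ {e}) ＼ {e'}) X = q → X.card ≤ q + 1 := by
  intro X hX hXr
  have hXE : (X : Set α) ⊆ (M.E \ {e}) \ {e'} := by
    rw [← Matroid.contract_ground, ← Matroid.delete_ground, ← coe_gr]
    exact_mod_cast hX
  have hXe : (X : Set α) ⊆ M.E \ {e} := hXE.trans Set.sdiff_subset
  have heX : e ∉ X := fun h => (hXe (Finset.mem_coe.2 h)).2 rfl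
  have hXg : X ⊆ gr M := subset_gr_of_coe_subset (hXe.trans Set.sdiff_subset)
  have heg : e ∈ gr M := mem_gr_of_mem_ground (he.subset_ground (mem_singleton e))
  rw [rkN_eq_iff] at hXr
  rw [delete_singleton_eRk_eq (M := M ／ {e}) (by rw [Matroid.contract_ground]; exact hXE)] at hXr
  have h2 := contract_singleton_eRk_add_one he hXe
  rw [hXr, ← Finset.coe_insert, ← coe_rkN] at h2
  have h3 : rkN M (insert e X) = q + 1 := by exact_mod_cast h2.symm
  have := hthin (insert e X) (Finset.insert_subset heg hXg) h3
  rw [Finset.card_insert_of_notMem heX] at this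
  omega

/-- Adding a point of the closure of `X` does not change the rank (`rkN` form). -/
theorem rkN_insert_eq_of_mem_closure {X : Finset α} (hX : (X : Set α) ⊆ M.E) {e : α}
    (he : e ∈ M.closure (X : Set α)) : rkN M (insert e X) = rkN M X := by
  rw [rkN_eq_iff, Finset.coe_insert, eRk_insert_eq_of_mem_closure hX he, coe_rkN]

/-- A thin(q) matroid (`q ≥ 2`) of rank `≥ q` with a loop `e`: `M ＼ {e}` is simple (a dependent set `T` of `≤ 2` points of
`M ＼ {e}` would give `T ∪ {e}` of nullity `≥ 2`). -/
theorem simple_delete_of_isLoop {q : ℕ} (hq : 2 ≤ q) (hthin : ∀ X ⊆ gr M, rkN M X = q → X.card ≤ q + 1)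
    (hE : q ≤ rkN M (gr M)) {e : α} (he : M.IsLoop e) :
    ∀ T ⊆ (M ＼ {e}).E, T.encard ≤ 2 → (M ＼ {e}).Indep T := by
  by_contra h
  obtain ⟨X, hXE, hX2, hXdep⟩ := exists_finset_of_not_simple (M ＼ {e}) h
  rw [Matroid.delete_ground] at hXE
  have heX : e ∉ X := fun hx => (hXE (Finset.mem_coe.2 hx)).2 rfl
  have hXdep' : ¬ M.Indep (X : Set α) := fun hI =>
    hXdep (Matroid.delete_indep_iff.2 ⟨hI, Set.disjoint_singleton_right.2 (by exact_mod_cast heX)⟩)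
  have hXr := rkN_lt_card_of_not_indep hXdep'
  have hXg : X ⊆ gr M := subset_gr_of_coe_subset (hXE.trans Set.sdiff_subset)
  have heg : e ∈ gr M := mem_gr_of_mem_ground he.mem_ground
  have hY : rkN M (insert e X) = rkN M X :=
    rkN_insert_eq_of_mem_closure (hXE.trans Set.sdiff_subset) (he.mem_closure _)
  have hnull := card_le_rkN_add_one_of_thin hthin hE (Finset.insert_subset heg hXg) (by rw [hY]; omega)
  rw [Finset.card_insert_of_notMem heX, hY] at hnull
  omega

/-- A thin(q) matroid (`q ≥ 2`) of rank `≥ q` with a parallel pair `e ∈ cl{e'}`: `M ＼ {e}` is simple (a dependent set `T` of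
`≤ 2` points of `M ＼ {e}` would give `T ∪ {e, e'}` of nullity `≥ 2`, whether or not `e' ∈ T`). -/
theorem simple_delete_of_parallel {q : ℕ} (hq : 2 ≤ q) (hthin : ∀ X ⊆ gr M, rkN M X = q → X.card ≤ q + 1)
    (hE : q ≤ rkN M (gr M)) {e e' : α} (he' : e' ∈ M.E) (hne : e' ≠ e) (hpar : e ∈ M.closure {e'}) :
    ∀ T ⊆ (M ＼ {e}).E, T.encard ≤ 2 → (M ＼ {e}).Indep T := by
  by_contra h
  obtain ⟨X, hXE, hX2, hXdep⟩ := exists_finset_of_not_simple (M ＼ {e}) h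
  rw [Matroid.delete_ground] at hXE
  have heX : e ∉ X := fun hx => (hXE (Finset.mem_coe.2 hx)).2 rfl
  have hXdep' : ¬ M.Indep (X : Set α) := fun hI =>
    hXdep (Matroid.delete_indep_iff.2 ⟨hI, Set.disjoint_singleton_right.2 (by exact_mod_cast heX)⟩)
  have hXr := rkN_lt_card_of_not_indep hXdep'
  have hXE' : (X : Set α) ⊆ M.E := hXE.trans Set.sdiff_subset
  have hXg : X ⊆ gr M := subset_gr_of_coe_subset hXE'
  have heg : e ∈ gr M := mem_gr_of_mem_ground (M.closure_subset_ground _ hpar)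
  have he'g : e' ∈ gr M := mem_gr_of_mem_ground he'
  by_cases he'X : e' ∈ X
  · -- `e ∈ cl{e'} ⊆ cl(X)`: `X ∪ {e}` has the rank of `X` and one more point
    have hY : rkN M (insert e X) = rkN M X :=
      rkN_insert_eq_of_mem_closure hXE'
        (M.closure_subset_closure (Set.singleton_subset_iff.2 (Finset.mem_coe.2 he'X)) hpar)
    have hnull := card_le_rkN_add_one_of_thin hthin hE (Finset.insert_subset heg hXg) (by rw [hY]; omega)
    rw [Finset.card_insert_of_notMem heX, hY] at hnull
    omega
  · -- `X ∪ {e', e}` has rank `≤ ρ(X) + 1` and two more points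
    have hX'E : ((insert e' X : Finset α) : Set α) ⊆ M.E := by
      rw [Finset.coe_insert]
      exact insert_subset he' hXE'
    have hY : rkN M (insert e (insert e' X)) = rkN M (insert e' X) :=
      rkN_insert_eq_of_mem_closure hX'E
        (M.closure_subset_closure (Set.singleton_subset_iff.2 (by rw [Finset.coe_insert]; exact mem_insert e' _)) hpar)
    have hY1 : rkN M (insert e' X) ≤ rkN M X + 1 := by
      have h := M.eRk_insert_le_add_one e' (X : Set α)
      rw [← Finset.coe_insert, ← coe_rkN, ← coe_rkN] at h
      exact_mod_cast h
    have heX' : e ∉ insert e' X := by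
      rw [Finset.mem_insert]
      rintro (h | h)
      · exact hne h.symm
      · exact heX h
    have hnull := card_le_rkN_add_one_of_thin hthin hE
      (Finset.insert_subset heg (Finset.insert_subset he'g hXg)) (by rw [hY]; omega)
    rw [Finset.card_insert_of_notMem heX', Finset.card_insert_of_notMem he'X, hY] at hnull
    omega

/-- A thin(q) matroid (`q ≥ 2`) of rank `≥ q` with a parallel pair `e' ∈ cl{e}`, `e` a non-loop: `(M ／ {e}) ＼ {e'}` is simple (a
dependent set `T` of `≤ 2` points of `M ／ {e}` avoiding `e'` would give `T ∪ {e, e'}` of nullity `≥ 2` in `M`). -/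
theorem simple_contract_delete_of_parallel {q : ℕ} (hq : 2 ≤ q)
    (hthin : ∀ X ⊆ gr M, rkN M X = q → X.card ≤ q + 1) (hE : q ≤ rkN M (gr M)) {e e' : α}
    (he : M.Indep {e}) (he' : e' ∈ M.E) (hne : e' ≠ e) (hpar' : e' ∈ M.closure {e}) :
    ∀ T ⊆ ((M ／ {e}) ＼ {e'}).E, T.encard ≤ 2 → ((M ／ {e}) ＼ {e'}).Indep T := by
  by_contra h
  obtain ⟨X, hXE, hX2, hXdep⟩ := exists_finset_of_not_simple ((M ／ {e}) ＼ {e'}) h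
  rw [Matroid.delete_ground, Matroid.contract_ground] at hXE
  have hXe : (X : Set α) ⊆ M.E \ {e} := hXE.trans Set.sdiff_subset
  have hXE' : (X : Set α) ⊆ M.E := hXe.trans Set.sdiff_subset
  have heX : e ∉ X := fun hx => (hXe (Finset.mem_coe.2 hx)).2 rfl
  have he'X : e' ∉ X := fun hx => (hXE (Finset.mem_coe.2 hx)).2 rfl
  have hXdep' : ¬ (M ／ {e}).Indep (X : Set α) := fun hI =>
    hXdep (Matroid.delete_indep_iff.2 ⟨hI, Set.disjoint_singleton_right.2 (by exact_mod_cast he'X)⟩)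
  have hXr := rkN_lt_card_of_not_indep hXdep'
  -- `ρ_M(X ∪ {e}) = ρ_{M/e}(X) + 1 ≤ |X|`
  have h2 := contract_singleton_eRk_add_one he hXe
  rw [← Finset.coe_insert, ← coe_rkN, ← coe_rkN] at h2
  have h3 : rkN M (insert e X) = rkN (M ／ {e}) X + 1 := by exact_mod_cast h2.symm
  have hXg : X ⊆ gr M := subset_gr_of_coe_subset hXE'
  have heg : e ∈ gr M := mem_gr_of_mem_ground (he.subset_ground (mem_singleton e))
  have he'g : e' ∈ gr M := mem_gr_of_mem_ground he'
  have hX'E : ((insert e X : Finset α) : Set α) ⊆ M.E := by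
    rw [Finset.coe_insert]
    exact insert_subset (he.subset_ground (mem_singleton e)) hXE'
  have hY : rkN M (insert e' (insert e X)) = rkN M (insert e X) :=
    rkN_insert_eq_of_mem_closure hX'E
      (M.closure_subset_closure (Set.singleton_subset_iff.2 (by rw [Finset.coe_insert]; exact mem_insert e _)) hpar')
  have he'X' : e' ∉ insert e X := by
    rw [Finset.mem_insert]
    rintro (h | h)
    · exact hne h
    · exact he'X h
  have hnull := card_le_rkN_add_one_of_thin hthin hE
    (Finset.insert_subset he'g (Finset.insert_subset heg hXg)) (by rw [hY]; omega)
  rw [Finset.card_insert_of_notMem he'X', Finset.card_insert_of_notMem heX, hY] at hnull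
  omega

omit [DecidableEq α] [M.Finite] in
/-- In `M ／ {e}` every point of `cl_M{e}` other than `e` is a loop. -/
theorem isLoop_contract_of_mem_closure {e e' : α} (hne : e' ≠ e) (hpar' : e' ∈ M.closure {e}) :
    (M ／ {e}).IsLoop e' := by
  rw [Matroid.isLoop_iff, Matroid.contract_loops_eq]
  exact ⟨hpar', fun h => hne (mem_singleton_iff.1 h)⟩

/-- A loopless finite matroid that is not simple has a parallel pair: distinct non-loops `e, e'` with `e ∈ cl{e'}` and `e' ∈ cl{e}`. -/
theorem exists_parallel_of_not_simple (hnl : ∀ x ∈ M.E, M.Indep {x})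
    (h : ¬ ∀ T ⊆ M.E, T.encard ≤ 2 → M.Indep T) :
    ∃ e e', e ∈ M.E ∧ e' ∈ M.E ∧ e' ≠ e ∧ e ∈ M.closure {e'} ∧ e' ∈ M.closure {e} := by
  obtain ⟨X, hXE, hX2, hXdep⟩ := exists_finset_of_not_simple M h
  have hX2' : X.card = 2 := by
    rcases Nat.lt_or_ge X.card 2 with hlt | hge
    · exfalso
      apply hXdep
      have hlt' : X.card ≤ 1 := by omega
      rw [Finset.card_le_one] at hlt'
      -- `X` is empty or a singleton `{x}` with `x` a non-loop
      rcases Finset.eq_empty_or_nonempty X with hemp | ⟨x, hx⟩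
      · rw [hemp, Finset.coe_empty]
        exact M.empty_indep
      · have hXx : X = {x} := by
          ext y
          constructor
          · intro hy
            rw [Finset.mem_singleton]
            exact hlt' y hy x hx
          · intro hy
            rw [Finset.mem_singleton] at hy
            rw [hy]
            exact hx
        rw [hXx, Finset.coe_singleton]
        exact hnl x (hXE (Finset.mem_coe.2 hx))
    · omega
  obtain ⟨a, b, hab, rfl⟩ := Finset.card_eq_two.1 hX2'
  have haE : a ∈ M.E := hXE (by simp)
  have hbE : b ∈ M.E := hXE (by simp)
  have hcoe : (({a, b} : Finset α) : Set α) = insert a {b} := by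
    rw [Finset.coe_insert, Finset.coe_singleton]
  rw [hcoe] at hXdep
  -- `a ∈ cl{b}`
  have hab' : a ∈ M.closure {b} := by
    by_contra hna
    apply hXdep
    rw [(hnl b hbE).insert_indep_iff_of_notMem (by simpa using hab)]
    exact ⟨haE, hna⟩
  -- `b ∈ cl{a}` by symmetry of the pair
  have hba' : b ∈ M.closure {a} := by
    by_contra hnb
    apply hXdep
    rw [Set.pair_comm, (hnl a haE).insert_indep_iff_of_notMem (by simpa using hab.symm)]
    exact ⟨hbE, hnb⟩
  exact ⟨a, b, haE, hbE, hab.symm, hab', hba'⟩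

omit [DecidableEq α] in
/-- The rank of the ground set as `rkN`, from a lower bound on `M.eRank`. -/
theorem le_rkN_gr_of_le_eRank {k : ℕ} (hk : (k : ℕ∞) ≤ M.eRank) : k ≤ rkN M (gr M) := by
  have h1 : M.eRank = (rkN M (gr M) : ℕ∞) := by rw [coe_rkN, coe_gr, Matroid.eRank_def]
  rw [h1] at hk
  exact_mod_cast hk

/-- **C-025 AT `(q + 2, q)` ON EVERY THIN(q) MATROID, `q ≥ 2`**: every finite matroid in which every rank-`q` set has at most `q + 1`
points — simple or not — satisfies the rank level-set inequality `ThmN.RLS M (q + 2) q`.  A loop halves both counts into g16's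
`rls_succ_succ_thin_simple` on `M ＼ {e}`; a parallel pair `e ∥ e'` is Theorem F on `M ＼ {e}` at `(q + 2, q)` and on
`M ／ {e}` at `(q + 1, q − 1)`, where `e'` is a loop and `(M ／ {e}) ＼ {e'}` is simple and thin(q − 1). -/
theorem rls_succ_succ_thin (q : ℕ) (hq : 2 ≤ q)
    (hthin : ∀ X ⊆ gr M, rkN M X = q → X.card ≤ q + 1) : ThmN.RLS M (q + 2) q := by
  rcases lt_or_ge M.eRank ((q + 2 : ℕ) : ℕ∞) with hR | hR
  · exact ThmN.RLS_of_eRank_lt M hR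
  have hE : q ≤ rkN M (gr M) := by
    have := le_rkN_gr_of_le_eRank hR
    omega
  by_cases hloop : ∃ e, M.IsLoop e
  · obtain ⟨e, he⟩ := hloop
    exact ThmN.RLS_of_loop_q M he (q + 2) q
      (rls_succ_succ_thin_simple q (simple_delete_of_isLoop hq hthin hE he) (thin_delete hthin e))
  have hnl : ∀ x ∈ M.E, M.Indep {x} := by
    intro x hx
    exact Matroid.indep_singleton.2 ((Matroid.not_isLoop_iff hx).1 (fun h => hloop ⟨x, h⟩))
  by_cases hsimple : ∀ T ⊆ M.E, T.encard ≤ 2 → M.Indep T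
  · exact rls_succ_succ_thin_simple q hsimple hthin
  obtain ⟨e, e', heE, he'E, hne, hpar, hpar'⟩ := exists_parallel_of_not_simple hnl hsimple
  have he : M.Indep {e} := hnl e heE
  obtain ⟨q', rfl⟩ : ∃ q', q = q' + 1 := ⟨q - 1, by omega⟩
  refine ThmN.RLS_of_parallel_q M (p := q' + 2) (q := q') he he'E hne hpar ?_ ?_
  · exact rls_succ_succ_thin_simple (q' + 1) (simple_delete_of_parallel hq hthin hE he'E hne hpar)
      (thin_delete hthin e)
  · exact ThmN.RLS_of_loop_q (M ／ {e}) (isLoop_contract_of_mem_closure hne hpar') (q' + 2) q'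
      (rls_succ_succ_thin_simple q' (simple_contract_delete_of_parallel hq hthin hE he he'E hne hpar')
        (thin_contract_delete hthin he))

/-- C-025 at `(q + 2, q)` on every thin(q) matroid, `q ≥ 2`, with thinness in `M.Indep` / `encard` terms: every set `T ⊆ E` of
`q + 2` points contains an independent set of `q + 1` points — i.e. no set of `q + 2` points has rank `≤ q`. -/
theorem rls_succ_succ_thin_indep (q : ℕ) (hq : 2 ≤ q)
    (hthin : ∀ T ⊆ M.E, T.encard = (q + 2 : ℕ) → (q + 1 : ℕ∞) ≤ M.eRk T) : ThmN.RLS M (q + 2) q := by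
  apply rls_succ_succ_thin q hq
  intro X hXg hXr
  by_contra hc
  push Not at hc
  -- a `(q + 2)`-subset of `X` has rank `≤ ρ(X) = q`
  obtain ⟨Y, hYX, hYc⟩ := Finset.exists_subset_card_eq (show q + 2 ≤ X.card by omega)
  have hYE : (Y : Set α) ⊆ M.E := by
    rw [← coe_gr]
    exact_mod_cast hYX.trans hXg
  have h1 := hthin Y hYE (by rw [Set.encard_coe_eq_coe_finsetCard, hYc])
  have h2 : rkN M Y ≤ rkN M X := rkN_mono hYX
  rw [← coe_rkN] at h1
  have h3 : q + 1 ≤ rkN M Y := by exact_mod_cast h1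
  omega

end ThinGirth
end PercRepro
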